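import Summits.PneNP.PneNP.Theorems.ChebyshevTracialDesignProjectionDilation
import Literature.Barriers.PneNP.MatchingSlackPsdSupportBarrier
import Summits.PneNP.PneNP.Theses.ChebyshevTracialDesign
import HarnessLib

/-!
# Cell pnp-psdrank, route `ChebyshevTracialDesign`: the TIGHTNESS-FREE CORE of the crux — `TracialDecayExp20` forces tracial decay of the
# squared-slack design `W·(cc−1)²` against COMPLETELY UNCONSTRAINED psd strategies (crux stmt-PneNP-19878; leaf file)

Brick 42 (prover g9; leaf — imports the route file). Let `ψ_U = rowFactor U`, `φ_M = colFactor M ∈ ℝ^{E(K_n) ⊔ 1}` be the tree's factorisation of the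
slack, `⟨ψ_U, φ_M⟩ = pmOddCutSlack n U M = cc(U,M) − 1` (`MatchingSlackPsdSupportBarrier.pmOddCutSlack_eq_sum_factor`), `m = |E(K_n)| + 1`. For ANY psd
contractions `X'_U`, `Y'_M` of dimension `s` — no tightness whatsoever — the Kronecker products

  `X_U := (ψ_Uψ_Uᵀ/m) ⊗ X'_U`,  `Y_M := (φ_Mφ_Mᵀ/m) ⊗ Y'_M`   (dimension `m·s`)

form a TIGHT-ORTHOGONAL psd rectangle (`X_U Y_M = (⟨ψ,φ⟩/m²)·ψφᵀ ⊗ X'Y' = 0` on the tight pairs, for free) with `tr(X_U Y_M) = (cc−1)²/m² · tr(X'_U Y'_M)`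
(§1–§2). Hence (`unconstrained_sqSlack_decay_of_crux`, §3):

  `TracialDecayExp20 ⇒ ∃ a > 0, ∀ large even n, ∀ balanced B = 20 designs W, ∀ s ≥ 1 with (m·s)²·n < exp(a·dq n), ∀ psd contractions X', Y' of dim s:
     (1/s)·Σ_{U,M} W(U,M)·(cc(U,M)−1)²·tr(X'_U Y'_M) ≤ m³·exp(−a·dq n)`.

Reading (MEMO-12 §4): the weight `W̃ = W·(cc−1)²` is again an exact extrapolation design (`w̃_c = w_c(c−1)²`, degree `dq n − 2`, variation `≤ 20·Tq(n)²`), so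
the crux contains a tracial-decay statement with NO tightness constraint at all, for every dimension up to `e^{a·dq n/2}/(m√n)`: the difficulty of the
crux is not the propagation of tightness but the harmonic-analytic question whether a low-dimensional psd kernel `tr(X'_UY'_M)/s` can correlate with the
crossing level at scale `e^{−a·dq n}`. At `s = 1` the consequence reads: EVERY 0/1 rectangle (tight-free or not) has `Σ_{A×B} W(U,M)(cc−1)² ≤ m³e^{−a·dq n}`.
A refutation of the displayed consequence refutes the crux (cheapest falsifier: see-saw over unconstrained contractions). [cite: FawziEtAl2015, Thm. 2.9 (v) (p06–p07)]
[cite: BrietDadushPokutta2014, Thm. 6 (§3)] [cite: Rothvoss2017, §2 (PDF pp. 5–6)]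
Stature: support/instrument (a necessary condition for the crux). WHAT THIS IS NOT: neither a proof nor a refutation of the crux, nothing on psd rank of
P_PM, no P-vs-NP content.
-/

set_option linter.dupNamespace false -- `Summit.PneNP.PneNP.…`: summit = sub-problem (D-0017)

noncomputable section

namespace Summit.PneNP.PneNP.Theorems.ChebyshevTracialDesignUnconstrainedSquareSlack

open scoped Kronecker

open Finset Matrix Literature.Barriers.PneNP Literature.Combinatorics.Optimization

variable {n : ℕ}

/-! ### §1 Rank-one contractions from bounded vectors -/

/-- For a real vector `v` on a finite type `ι` with `Σ v² ≤ m` (`0 < m`): `P = (1/m)·v vᵀ` satisfies `0 ⪯ P ⪯ I`. -/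
theorem contraction_rankOne {ι : Type*} [Fintype ι] [DecidableEq ι] (v : ι → ℝ) {m : ℝ} (hm : 0 < m) (hv : v ⬝ᵥ v ≤ m) :
    ((1 / m) • vecMulVec v v).PosSemidef ∧ (1 - (1 / m) • vecMulVec v v).PosSemidef := by
  have hP : ((1 / m) • vecMulVec v v).PosSemidef := by
    have h := posSemidef_vecMulVec_self_star v
    rw [star_trivial] at h
    exact h.smul (by positivity)
  refine ⟨hP, PosSemidef.of_dotProduct_mulVec_nonneg (isHermitian_one.sub hP.1) fun z => ?_⟩
  have key : z ⬝ᵥ (vecMulVec v v *ᵥ z) = (v ⬝ᵥ z) * (z ⬝ᵥ v) := by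
    calc z ⬝ᵥ (vecMulVec v v *ᵥ z) = ∑ i, z i * ∑ j, v i * v j * z j := by
          simp only [dotProduct, mulVec, vecMulVec_apply]
      _ = ∑ i, ∑ j, (z i * v i) * (v j * z j) := by
          refine Finset.sum_congr rfl fun i _ => ?_
          rw [Finset.mul_sum]
          exact Finset.sum_congr rfl fun j _ => by ring
      _ = (∑ i, z i * v i) * ∑ j, v j * z j := by rw [Finset.sum_mul_sum]
      _ = (v ⬝ᵥ z) * (z ⬝ᵥ v) := by simp only [dotProduct]; ring
  rw [star_trivial, sub_mulVec, one_mulVec, dotProduct_sub, smul_mulVec, dotProduct_smul, key, smul_eq_mul, sub_nonneg]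
  -- Cauchy–Schwarz: `(v·z)² ≤ (v·v)(z·z) ≤ m (z·z)`
  have hzz : 0 ≤ z ⬝ᵥ z := by unfold dotProduct; exact sum_nonneg fun i _ => mul_self_nonneg _
  have hcs : (v ⬝ᵥ z) * (z ⬝ᵥ v) ≤ m * (z ⬝ᵥ z) := by
    rw [dotProduct_comm z v, ← sq]
    calc (v ⬝ᵥ z) ^ 2 ≤ (∑ i, v i ^ 2) * ∑ i, z i ^ 2 := sum_mul_sq_le_sq_mul_sq univ v z
      _ = (v ⬝ᵥ v) * (z ⬝ᵥ z) := by simp only [dotProduct, sq]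
      _ ≤ m * (z ⬝ᵥ z) := mul_le_mul_of_nonneg_right hv hzz
  calc 1 / m * ((v ⬝ᵥ z) * (z ⬝ᵥ v)) ≤ 1 / m * (m * (z ⬝ᵥ z)) := mul_le_mul_of_nonneg_left hcs (by positivity)
    _ = z ⬝ᵥ z := by field_simp

/-- Product of two rank-one contractions: `(v vᵀ/m)(w wᵀ/m) = (⟨v,w⟩/m²)·v wᵀ`. -/
theorem rankOne_mul_rankOne {ι : Type*} [Fintype ι] (v w : ι → ℝ) (m : ℝ) :
    ((1 / m) • vecMulVec v v) * ((1 / m) • vecMulVec w w) = ((v ⬝ᵥ w) / m ^ 2) • vecMulVec v w := by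
  rw [smul_mul_smul_comm, vecMulVec_mul_vecMulVec, vecMulVec_smul, smul_smul]
  congr 1
  ring

/-! ### §2 Kronecker products of contractions, re-indexed to `Fin (m·s)` -/

section Kron

variable {ι : Type} {s : ℕ}

/-- `(A − B) ⊗ C = A ⊗ C − B ⊗ C`. -/
theorem sub_kronecker (A B : Matrix ι ι ℝ) (C : Matrix (Fin s) (Fin s) ℝ) : (A - B) ⊗ₖ C = A ⊗ₖ C - B ⊗ₖ C := by
  ext ⟨i, k⟩ ⟨j, l⟩; simp [kroneckerMap_apply, sub_mul]

/-- `A ⊗ (C − D) = A ⊗ C − A ⊗ D`. -/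
theorem kronecker_sub (A : Matrix ι ι ℝ) (C D : Matrix (Fin s) (Fin s) ℝ) : A ⊗ₖ (C - D) = A ⊗ₖ C - A ⊗ₖ D := by
  ext ⟨i, k⟩ ⟨j, l⟩; simp [kroneckerMap_apply, mul_sub]

variable [Fintype ι] [DecidableEq ι]

/-- **The Kronecker product of two contractions is a contraction**: `0 ⪯ A, 1 − A, C, 1 − C ⇒ 0 ⪯ A ⊗ C ⪯ I`. -/
theorem contraction_kronecker {A : Matrix ι ι ℝ} {C : Matrix (Fin s) (Fin s) ℝ} (hA : A.PosSemidef ∧ (1 - A).PosSemidef)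
    (hC : C.PosSemidef ∧ (1 - C).PosSemidef) : (A ⊗ₖ C).PosSemidef ∧ (1 - A ⊗ₖ C).PosSemidef := by
  refine ⟨hA.1.kronecker hC.1, ?_⟩
  have e : (1 : Matrix (ι × Fin s) (ι × Fin s) ℝ) - A ⊗ₖ C = (1 - A) ⊗ₖ C + (1 : Matrix ι ι ℝ) ⊗ₖ (1 - C) := by
    rw [sub_kronecker, kronecker_sub, one_kronecker_one]; abel
  rw [e]
  exact (hA.2.kronecker hC.1).add (PosSemidef.one.kronecker hC.2)

omit [DecidableEq ι] in
/-- Flattening is multiplicative. -/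
theorem flat_mul (A B : Matrix (ι × Fin s) (ι × Fin s) ℝ) :
    A.submatrix (((Fintype.equivFin ι).prodCongr (Equiv.refl (Fin s))).trans finProdFinEquiv).symm
        (((Fintype.equivFin ι).prodCongr (Equiv.refl (Fin s))).trans finProdFinEquiv).symm *
      B.submatrix (((Fintype.equivFin ι).prodCongr (Equiv.refl (Fin s))).trans finProdFinEquiv).symm
        (((Fintype.equivFin ι).prodCongr (Equiv.refl (Fin s))).trans finProdFinEquiv).symm =
      (A * B).submatrix (((Fintype.equivFin ι).prodCongr (Equiv.refl (Fin s))).trans finProdFinEquiv).symm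
        (((Fintype.equivFin ι).prodCongr (Equiv.refl (Fin s))).trans finProdFinEquiv).symm :=
  submatrix_mul_equiv _ _ _ _ _

omit [DecidableEq ι] in
/-- Flattening preserves the trace. -/
theorem trace_flat (A : Matrix (ι × Fin s) (ι × Fin s) ℝ) :
    (A.submatrix (((Fintype.equivFin ι).prodCongr (Equiv.refl (Fin s))).trans finProdFinEquiv).symm
      (((Fintype.equivFin ι).prodCongr (Equiv.refl (Fin s))).trans finProdFinEquiv).symm).trace = A.trace := by
  simp only [trace, diag_apply, submatrix_apply]
  exact (((Fintype.equivFin ι).prodCongr (Equiv.refl (Fin s))).trans finProdFinEquiv).symm.sum_comp (fun p => A p p)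

/-- Flattening preserves `0 ⪯ · ⪯ I`. -/
theorem contraction_flat {A : Matrix (ι × Fin s) (ι × Fin s) ℝ} (hA : A.PosSemidef ∧ (1 - A).PosSemidef) :
    (A.submatrix (((Fintype.equivFin ι).prodCongr (Equiv.refl (Fin s))).trans finProdFinEquiv).symm
        (((Fintype.equivFin ι).prodCongr (Equiv.refl (Fin s))).trans finProdFinEquiv).symm).PosSemidef ∧
      (1 - A.submatrix (((Fintype.equivFin ι).prodCongr (Equiv.refl (Fin s))).trans finProdFinEquiv).symm
        (((Fintype.equivFin ι).prodCongr (Equiv.refl (Fin s))).trans finProdFinEquiv).symm).PosSemidef := by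
  refine ⟨hA.1.submatrix _, ?_⟩
  have e : 1 - A.submatrix (((Fintype.equivFin ι).prodCongr (Equiv.refl (Fin s))).trans finProdFinEquiv).symm
        (((Fintype.equivFin ι).prodCongr (Equiv.refl (Fin s))).trans finProdFinEquiv).symm =
      (1 - A).submatrix (((Fintype.equivFin ι).prodCongr (Equiv.refl (Fin s))).trans finProdFinEquiv).symm
        (((Fintype.equivFin ι).prodCongr (Equiv.refl (Fin s))).trans finProdFinEquiv).symm := by
    rw [← submatrix_one_equiv (((Fintype.equivFin ι).prodCongr (Equiv.refl (Fin s))).trans finProdFinEquiv).symm]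
    rfl
  rw [e]; exact hA.2.submatrix _

end Kron

/-! ### §3 The reduction: the crux implies unconstrained decay of the squared-slack design -/

/-- Entries of the slack factors lie in `{0, ±1}`: `Σ_x ψ_U(x)² ≤ m` and `Σ_x φ_M(x)² ≤ m`, `m = |E(K_n) ⊔ 1|`. -/
theorem rowFactor_sq_le (U : OddSet n) : rowFactor U ⬝ᵥ rowFactor U ≤ Fintype.card (Edge n ⊕ Unit) := by
  calc rowFactor U ⬝ᵥ rowFactor U = ∑ x, rowFactor U x * rowFactor U x := rfl
    _ ≤ ∑ _x : Edge n ⊕ Unit, (1 : ℝ) := sum_le_sum fun x _ => by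
        rcases x with e | u
        · simp only [rowFactor]; split_ifs <;> norm_num
        · simp [rowFactor]
    _ = Fintype.card (Edge n ⊕ Unit) := by simp

/-- Companion bound for the column factor. -/
theorem colFactor_sq_le (M : PMatch n) : colFactor M ⬝ᵥ colFactor M ≤ Fintype.card (Edge n ⊕ Unit) := by
  calc colFactor M ⬝ᵥ colFactor M = ∑ x, colFactor M x * colFactor M x := rfl
    _ ≤ ∑ _x : Edge n ⊕ Unit, (1 : ℝ) := sum_le_sum fun x _ => by
        rcases x with e | u
        · simp only [colFactor]; split_ifs <;> norm_num
        · simp [colFactor]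
    _ = Fintype.card (Edge n ⊕ Unit) := by simp

/-- `⟨ψ_U, φ_M⟩ = cc(U,M) − 1`. -/
theorem rowFactor_dot_colFactor (U : OddSet n) (M : PMatch n) : rowFactor U ⬝ᵥ colFactor M = pmOddCutSlack n U M := by
  rw [pmOddCutSlack_eq_sum_factor]; rfl

/-- **The crux forces unconstrained decay of the squared-slack design.** If `TracialDecayExp20` holds then for some `a > 0` and all large even `n`:
for every balanced `B = 20` design `(t, C, w)`, every `s ≥ 1` with `(m·s)²·n < exp(a·dq n)` (`m = |E(K_n)| + 1 = C(n,2) + 1`), and ALL psd contractions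
`X'_U`, `Y'_M` of dimension `s` (no tightness condition):
`(1/s)·Σ_{U,M} W(U,M)·(pmOddCutSlack n U M)²·tr(X'_U Y'_M) ≤ m³·exp(−a·dq n)`.
[cite: FawziEtAl2015, Thm. 2.9 (v) (p06–p07)] [cite: BrietDadushPokutta2014, Thm. 6 (§3)] -/
theorem unconstrained_sqSlack_decay_of_crux (hcrux : Summit.PneNP.PneNP.Theses.ChebyshevTracialDesign.TracialDecayExp20) :
    ∃ a : ℝ, 0 < a ∧ ∃ n₁ : ℕ, ∀ n : ℕ, n₁ ≤ n → Even n → ∀ (t : ℕ) (C : Finset ℕ) (w : ℕ → ℝ),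
      IsBalancedDesign n t (Tq n) (dq n) 20 C w → ∀ s : ℕ, 0 < s →
        ((Fintype.card (Edge n ⊕ Unit) * s : ℕ) : ℝ) ^ 2 * n < Real.exp (a * (dq n : ℝ)) →
        ∀ (X' : OddSet n → Matrix (Fin s) (Fin s) ℝ) (Y' : PMatch n → Matrix (Fin s) (Fin s) ℝ),
          (∀ U, (X' U).PosSemidef ∧ (1 - X' U).PosSemidef) → (∀ M, (Y' M).PosSemidef ∧ (1 - Y' M).PosSemidef) →
            (∑ U, ∑ M, levelWeight n t C w U M * pmOddCutSlack n U M ^ 2 * (X' U * Y' M).trace) / s ≤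
              (Fintype.card (Edge n ⊕ Unit) : ℝ) ^ 3 * Real.exp (-(a * (dq n : ℝ))) := by
  obtain ⟨a, ha, n₁, h⟩ := hcrux
  refine ⟨a, ha, n₁, fun n hn hev t C w hdes s hs hbud X' Y' hX' hY' => ?_⟩
  have hmpos : 0 < Fintype.card (Edge n ⊕ Unit) := Fintype.card_pos
  have hm : (0 : ℝ) < (Fintype.card (Edge n ⊕ Unit) : ℝ) := by exact_mod_cast hmpos
  -- the lifted strategy of dimension `m * s`
  set PX : OddSet n → Matrix (Edge n ⊕ Unit) (Edge n ⊕ Unit) ℝ :=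
    fun U => (1 / (Fintype.card (Edge n ⊕ Unit) : ℝ)) • vecMulVec (rowFactor U) (rowFactor U) with hPX
  set PY : PMatch n → Matrix (Edge n ⊕ Unit) (Edge n ⊕ Unit) ℝ :=
    fun M => (1 / (Fintype.card (Edge n ⊕ Unit) : ℝ)) • vecMulVec (colFactor M) (colFactor M) with hPY
  set X : OddSet n → Matrix (Fin (Fintype.card (Edge n ⊕ Unit) * s)) (Fin (Fintype.card (Edge n ⊕ Unit) * s)) ℝ :=
    fun U => (PX U ⊗ₖ X' U).submatrix (((Fintype.equivFin (Edge n ⊕ Unit)).prodCongr (Equiv.refl (Fin s))).trans finProdFinEquiv).symm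
      (((Fintype.equivFin (Edge n ⊕ Unit)).prodCongr (Equiv.refl (Fin s))).trans finProdFinEquiv).symm with hX
  set Y : PMatch n → Matrix (Fin (Fintype.card (Edge n ⊕ Unit) * s)) (Fin (Fintype.card (Edge n ⊕ Unit) * s)) ℝ :=
    fun M => (PY M ⊗ₖ Y' M).submatrix (((Fintype.equivFin (Edge n ⊕ Unit)).prodCongr (Equiv.refl (Fin s))).trans finProdFinEquiv).symm
      (((Fintype.equivFin (Edge n ⊕ Unit)).prodCongr (Equiv.refl (Fin s))).trans finProdFinEquiv).symm with hY
  have hPXc : ∀ U, (PX U).PosSemidef ∧ (1 - PX U).PosSemidef := fun U => contraction_rankOne _ hm (rowFactor_sq_le U)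
  have hPYc : ∀ M, (PY M).PosSemidef ∧ (1 - PY M).PosSemidef := fun M => contraction_rankOne _ hm (colFactor_sq_le M)
  -- products and traces
  have hprod : ∀ U M, X U * Y M = ((PX U * PY M) ⊗ₖ (X' U * Y' M)).submatrix
      (((Fintype.equivFin (Edge n ⊕ Unit)).prodCongr (Equiv.refl (Fin s))).trans finProdFinEquiv).symm
      (((Fintype.equivFin (Edge n ⊕ Unit)).prodCongr (Equiv.refl (Fin s))).trans finProdFinEquiv).symm := fun U M => by
    rw [hX, hY]; dsimp only; rw [flat_mul, ← mul_kronecker_mul]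
  have hPP : ∀ U M, PX U * PY M =
      (pmOddCutSlack n U M / (Fintype.card (Edge n ⊕ Unit) : ℝ) ^ 2) • vecMulVec (rowFactor U) (colFactor M) := fun U M => by
    rw [hPX, hPY]; dsimp only; rw [rankOne_mul_rankOne, rowFactor_dot_colFactor]
  have htrace : ∀ U M, (X U * Y M).trace =
      pmOddCutSlack n U M ^ 2 / (Fintype.card (Edge n ⊕ Unit) : ℝ) ^ 2 * (X' U * Y' M).trace := fun U M => by
    rw [hprod, trace_flat, trace_kronecker, hPP, trace_smul, trace_vecMulVec, rowFactor_dot_colFactor, smul_eq_mul]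
    ring
  -- the lifted strategy is a tight-orthogonal psd rectangle
  have hXY : IsPsdRect X Y := by
    refine ⟨fun U => ?_, fun M => ?_, fun U M hUM => ?_⟩
    · rw [hX]; exact contraction_flat (contraction_kronecker (hPXc U) (hX' U))
    · rw [hY]; exact contraction_flat (contraction_kronecker (hPYc M) (hY' M))
    · rw [hprod, hPP]
      have h0 : pmOddCutSlack n U M = 0 := by rw [pmOddCutSlack_apply, hUM]; norm_num
      rw [h0, zero_div, zero_smul, zero_kronecker, submatrix_zero, Pi.zero_apply, Pi.zero_apply]
  -- apply the crux in dimension `m * s`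
  have hval := h n hn hev t C w hdes (Fintype.card (Edge n ⊕ Unit) * s) (Nat.mul_pos hmpos hs) hbud X Y hXY
  -- rewrite the value
  have hsum : ∑ U, ∑ M, levelWeight n t C w U M * (X U * Y M).trace =
      (1 / (Fintype.card (Edge n ⊕ Unit) : ℝ) ^ 2) *
        ∑ U, ∑ M, levelWeight n t C w U M * pmOddCutSlack n U M ^ 2 * (X' U * Y' M).trace := by
    rw [mul_sum]; refine sum_congr rfl fun U _ => ?_
    rw [mul_sum]; refine sum_congr rfl fun M _ => ?_
    rw [htrace]; ring
  rw [hsum] at hval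
  have hs' : (0 : ℝ) < s := by exact_mod_cast hs
  rw [div_le_iff₀ (by positivity)] at hval
  rw [div_le_iff₀ hs']
  have e1 : ((Fintype.card (Edge n ⊕ Unit) * s : ℕ) : ℝ) = (Fintype.card (Edge n ⊕ Unit) : ℝ) * s := by push_cast; ring
  rw [e1] at hval
  have h2 := mul_le_mul_of_nonneg_left hval (by positivity : (0 : ℝ) ≤ (Fintype.card (Edge n ⊕ Unit) : ℝ) ^ 2)
  calc ∑ U, ∑ M, levelWeight n t C w U M * pmOddCutSlack n U M ^ 2 * (X' U * Y' M).trace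
      = (Fintype.card (Edge n ⊕ Unit) : ℝ) ^ 2 * (1 / (Fintype.card (Edge n ⊕ Unit) : ℝ) ^ 2 *
          ∑ U, ∑ M, levelWeight n t C w U M * pmOddCutSlack n U M ^ 2 * (X' U * Y' M).trace) := by
        field_simp
    _ ≤ (Fintype.card (Edge n ⊕ Unit) : ℝ) ^ 2 * (Real.exp (-(a * (dq n : ℝ))) * ((Fintype.card (Edge n ⊕ Unit) : ℝ) * s)) := h2
    _ = (Fintype.card (Edge n ⊕ Unit) : ℝ) ^ 3 * Real.exp (-(a * (dq n : ℝ))) * s := by ring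

/-! ### §4 The rectangle case (`s = 1`): NTF — a rectangle decay statement with no tight-freeness (appended, prover g9)

The `s = 1` instance with indicator strategies `X'_U = 1[U ∈ A]·I₁`, `Y'_M = 1[M ∈ B]·I₁` is the consequence «NTF» isolated first by the cell's literature
seat (pnp-psdrank-lit g16, `Literature/Combinatorics/Optimization/TracialPureStateWitness.lean`, pure-state witness at dimension `C(n,2)+1`): the crux forces
`Σ_{U∈A, M∈B} W(U,M)·(cc(U,M)−1)² ≤ m³·exp(−a·dq n)` for EVERY rectangle `A × B` of cuts × matchings, tight-free or not. -/

/-- **The crux forces squared-slack rectangle decay without tight-freeness (NTF).** [cite: FawziEtAl2015, Thm. 2.9 (v) (p06–p07)]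
[cite: Rothvoss2017, §2 (PDF pp. 5–6)] -/
theorem rect_sqSlack_decay_of_crux (hcrux : Summit.PneNP.PneNP.Theses.ChebyshevTracialDesign.TracialDecayExp20) :
    ∃ a : ℝ, 0 < a ∧ ∃ n₁ : ℕ, ∀ n : ℕ, n₁ ≤ n → Even n → ∀ (t : ℕ) (C : Finset ℕ) (w : ℕ → ℝ),
      IsBalancedDesign n t (Tq n) (dq n) 20 C w →
        ((Fintype.card (Edge n ⊕ Unit) : ℕ) : ℝ) ^ 2 * n < Real.exp (a * (dq n : ℝ)) →
        ∀ (A : Finset (OddSet n)) (B : Finset (PMatch n)),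
          ∑ U ∈ A, ∑ M ∈ B, levelWeight n t C w U M * pmOddCutSlack n U M ^ 2 ≤
            (Fintype.card (Edge n ⊕ Unit) : ℝ) ^ 3 * Real.exp (-(a * (dq n : ℝ))) := by
  classical
  obtain ⟨a, ha, n₁, h⟩ := unconstrained_sqSlack_decay_of_crux hcrux
  refine ⟨a, ha, n₁, fun n hn hev t C w hdes hbud A B => ?_⟩
  -- indicator strategies of dimension `1`
  set X' : OddSet n → Matrix (Fin 1) (Fin 1) ℝ := fun U => (if U ∈ A then (1 : ℝ) else 0) • (1 : Matrix (Fin 1) (Fin 1) ℝ) with hX'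
  set Y' : PMatch n → Matrix (Fin 1) (Fin 1) ℝ := fun M => (if M ∈ B then (1 : ℝ) else 0) • (1 : Matrix (Fin 1) (Fin 1) ℝ) with hY'
  have hsmul : ∀ c : ℝ, 0 ≤ c → c ≤ 1 →
      (c • (1 : Matrix (Fin 1) (Fin 1) ℝ)).PosSemidef ∧ (1 - c • (1 : Matrix (Fin 1) (Fin 1) ℝ)).PosSemidef := fun c h0 h1 => by
    refine ⟨PosSemidef.one.smul h0, ?_⟩
    have e : (1 : Matrix (Fin 1) (Fin 1) ℝ) - c • (1 : Matrix (Fin 1) (Fin 1) ℝ) = (1 - c) • (1 : Matrix (Fin 1) (Fin 1) ℝ) := by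
      rw [sub_smul, one_smul]
    rw [e]; exact PosSemidef.one.smul (sub_nonneg.2 h1)
  have hX'c : ∀ U, (X' U).PosSemidef ∧ (1 - X' U).PosSemidef := fun U => by
    rw [hX']; dsimp only; split_ifs <;> [exact hsmul 1 zero_le_one le_rfl; exact hsmul 0 le_rfl zero_le_one]
  have hY'c : ∀ M, (Y' M).PosSemidef ∧ (1 - Y' M).PosSemidef := fun M => by
    rw [hY']; dsimp only; split_ifs <;> [exact hsmul 1 zero_le_one le_rfl; exact hsmul 0 le_rfl zero_le_one]
  have hbud1 : ((Fintype.card (Edge n ⊕ Unit) * 1 : ℕ) : ℝ) ^ 2 * n < Real.exp (a * (dq n : ℝ)) := by rwa [mul_one]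
  have hv := h n hn hev t C w hdes 1 Nat.one_pos hbud1 X' Y' hX'c hY'c
  rw [Nat.cast_one, div_one] at hv
  -- evaluate the value of the indicator strategies
  have htr : ∀ U M, (X' U * Y' M).trace = (if U ∈ A then (1 : ℝ) else 0) * (if M ∈ B then (1 : ℝ) else 0) := fun U M => by
    rw [hX', hY']; dsimp only
    rw [smul_mul_smul_comm, Matrix.one_mul, trace_smul, trace_one, Fintype.card_fin, Nat.cast_one, smul_eq_mul, mul_one]
  have hsum : ∑ U, ∑ M, levelWeight n t C w U M * pmOddCutSlack n U M ^ 2 * (X' U * Y' M).trace =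
      ∑ U ∈ A, ∑ M ∈ B, levelWeight n t C w U M * pmOddCutSlack n U M ^ 2 := by
    simp_rw [htr]
    rw [← sum_filter_add_sum_filter_not univ (fun U => U ∈ A)]
    have hz : ∑ U ∈ univ.filter (fun U => ¬ U ∈ A), ∑ M, levelWeight n t C w U M * pmOddCutSlack n U M ^ 2 *
        ((if U ∈ A then (1 : ℝ) else 0) * (if M ∈ B then (1 : ℝ) else 0)) = 0 :=
      sum_eq_zero fun U hU => by have hU' : U ∉ A := (mem_filter.1 hU).2; simp [hU']
    rw [hz, add_zero, filter_mem_eq_inter, univ_inter]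
    refine sum_congr rfl fun U hU => ?_
    rw [← sum_filter_add_sum_filter_not univ (fun M => M ∈ B)]
    have hz' : ∑ M ∈ univ.filter (fun M => ¬ M ∈ B), levelWeight n t C w U M * pmOddCutSlack n U M ^ 2 *
        ((if U ∈ A then (1 : ℝ) else 0) * (if M ∈ B then (1 : ℝ) else 0)) = 0 :=
      sum_eq_zero fun M hM => by have hM' : M ∉ B := (mem_filter.1 hM).2; simp [hM']
    rw [hz', add_zero, filter_mem_eq_inter, univ_inter]
    refine sum_congr rfl fun M hM => ?_
    simp [hU, hM]
  rw [hsum] at hv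
  exact hv

end Summit.PneNP.PneNP.Theorems.ChebyshevTracialDesignUnconstrainedSquareSlack

end
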